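/-
Copyright (c) 2026 the pub-hodgecm-mathlib formalisation cell (harness21).  Prover seat hodgecm-mathlib-R90-C10-p03 (g2), SLAB R90-TF, section S1 «Ch. 10∕12 local»;
crux H413 = `stmt-HodgeConjecture-24833`; (S-W) wild corner of U4Keys :182, card «θ-CM TWIN» RE-SCOPED to its (R-a)-with-defect part (dealer R90-C10-plan (g3)
2026-09-05T03:29:05Z (2); (S-W) line lead R90-C10-p05 (g3) census (W-3) a05eeedd08a85999; the minimal-`t` CM dress itself is R90-C10-p07 (g3)'s (W-0b)
`R90S1WildConcaveLevelMinOfRecord`, imported here).  KERNEL module: THEOREMS ONLY (no definition, no named fact, no `sorry`, no instance, no notation).  2026-09-05.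
-/
import Summits.HodgeConjecture.HodgeConjecture.Theorems.R90S1WildConcaveLevelMinOfRecord   -- (W-0b) (R90-C10-p07 (g3)): `theta_mul_concave_ofRecord` (θ multiplicative on `Je` for ANY trace-one `t ∈ L_w` under the `|t|`-weighted inequalities); brings ★ (v)-θ-CM p862709, ★ (O1) p863752, ★ (W-0) p865099
import HarnessLib

/-!
# R90-TF S1 «Ch10-local» ∕ K2 E3 «U4Keys» :182, (S-W) WILD corner — `θ(g) = χ₁(g₀₀)` IS MULTIPLICATIVE ON `J_e ⊂ U(Φ₃)(L⁺_v)` IN SUB-BRANCH (R-a) WITH THE DEFECT LETTER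
# «`χ₁ = 1` on the `σ`-fixed units of valuation one ⇒ the F-conductor letter at EVERY level; `|t|·|ϖ|^δ ≤ 1` and `n + δ ≤ s + 2r′`, `n + δ ≤ s′ + 2r` ⇒ the `|t|`-weighted concavity»
# — the CM twin of (W-3) §2 [Roche1998 §3; Tits1979 §1.15; BruhatTits1972 (6.4.9); MoyPrasad1996 §3]

Cell `pub/hodgecm-mathlib`, crux H413 = `stmt-HodgeConjecture-24833`, route of record `HCCMUnconditional` (no route verbs); R90-TF section S1 (base R90-C10), dealer
R90-C10-plan (g3) (ruling R-S1-36 «(S-W) first bricks»; card 03:29:05Z (2), re-scoped 03:43Z after the (W-0b) overlap), (S-W) line lead R90-C10-p05 (g3), auditor R90-C10-audit1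
(g3).  THEOREMS ONLY; lane `--supports stmt-HodgeConjecture-24833 --as helper`, count-neutral.  NOT THE PAYER of :182 ∕ (S-W): (S-W) `sig_K2E3KeysThmTwoContractingRamifiedCharOnePosDepthWild`
is the XL residual; this file is Road-I base-case INFRASTRUCTURE — the `hθmul` letter on `U(Φ₃)(L⁺_v)` in the (R-a) wild cell «`n ≥ δ`» of R90-C10-p02 (g3)'s census §4.

THE POINT.  (W-0b) `R90S1WildConcaveLevelMinOfRecord.theta_mul_concave_ofRecord` (R90-C10-p07 (g3), over ★ (v)-θ-CM `K2E3ConcaveLevelIwahoriCharacterCM`, ★ (O1)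
`K2E3ConcaveLevelIwahoriCharacterMin`, ★ (W-0) `R90S1WildTraceOneMinimal`) gives `θ(jj′) = θ(j)·θ(j′)` on `Je = eA⁻¹(Jg)` for `χ₁ : (L ⊗ L⁺_v)ˣ → ℂˣ` of E-conductor `≤ n`
(`hcond`) and F-conductor `≤ c` on the `(c ⊗ 1)`-fixed units (`hcondF`, `1 ≤ c ≤ e 0 2 + e 2 0`), ANY trace-one `t ∈ L_w`, under `n ≤ e 0 1 + e 1 0` and the `|t|`-WEIGHTED
inequalities `|t|·|ϖ|^{e 0 2 + 2·e 1 0} ≤ |ϖ|ⁿ`, `|t|·|ϖ|^{e 2 0 + 2·e 0 1} ≤ |ϖ|ⁿ` — any non-split place, wild included.  In the sub-branch (R-a) of Branch B (`hRa0`: `χ₁ a = 1`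
for EVERY `(c ⊗ 1)`-fixed unit `a` with `|a_{w′}| = 1` — ★ (a′)-R p864842's bytes) the letter `hcondF` holds at every level `c ≥ 1` (§1), and with the DEFECT LETTER
`hδ : |t|·|ϖ|^δ ≤ 1` (`δ = d − 1` at a wild place — ★ (W-0)'s minimal `t` has `|t| = |ϖ|^{−δ}`; `δ = 0` elsewhere) the weights follow from the ℕ-inequalities
`n + δ ≤ e 0 2 + 2·e 1 0`, `n + δ ≤ e 2 0 + 2·e 0 1` (§2) — EXACTLY the (R-a) cell «`n ≥ δ`» datum of (W-3) (R90-C10-p05 (g3)), whose MODEL head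
`chi_apply_zero_zero_mul_of_fixTrivial_of_defect` this file twins at the CM frame.
* §1 **`hcondF_of_fixTrivial`** — `hRa0 ⇒ hcondF` at every `c ≥ 1` (`|u_{w′} − 1| ≤ |ϖ|^c < 1 ⇒ |u_{w′}| = 1`).
* §2 **`theta_mul_of_fixTrivial_of_defect`** — (W-0b) `theta_mul_concave_ofRecord` at `c := 1`, `hcondF := §1`, weights `|t|·|ϖ|^k = (|t||ϖ|^δ)·|ϖ|^{k−δ} ≤ |ϖ|ⁿ` (`n + δ ≤ k`).
HONEST LABEL.  HC_CM is proved only modulo the 7 printed citations (2 remaining named inputs: hLiu418 = `stmt-HodgeConjecture-24832`, h413 = `stmt-HodgeConjecture-24833`) until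
rung 0 closes; count-neutral — this file pays NO socket ((S-W) ∕ :182 ∕ A2′ ∕ C :88∕:98 OPEN); no printed citation is discharged; REL ≠ ★ ≠ BUILT.

## References
* [Roche1998] A. Roche, *Types and Hecke algebras for principal series representations of split reductive p-adic groups*, Ann. Sci. ÉNS (4) 31 (1998), §3.
* [Tits1979] J. Tits, *Reductive groups over local fields*, Proc. Sympos. Pure Math. 33.1 (1979), §1.15 (the ramified quasi-split `SU₃` and its maximal trace element).
* [BruhatTits1972] F. Bruhat, J. Tits, *Groupes réductifs sur un corps local I*, Publ. Math. IHÉS 41 (1972), (6.4.9).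
* [MoyPrasad1996] A. Moy, G. Prasad, *Jacquet functors and unrefined minimal K-types*, Comment. Math. Helv. 71 (1996), §3.
-/

set_option autoImplicit false
-- the mandated namespace has the single-problem summit's repeated segment (`HodgeConjecture.HodgeConjecture`)
set_option linter.dupNamespace false

noncomputable section

open NumberField IsDedekindDomain
open scoped Matrix MatrixGroups WithZero Valued
open Literature.NumberTheory Literature.NumberTheory.Automorphic Literature.NumberTheory.Automorphic.UnitaryGroup
open Literature.NumberTheory.Rogawski1990

namespace Summit.HodgeConjecture.HodgeConjecture.R90.S1.WildThetaMulConcaveMinCM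

open Summit.HodgeConjecture.HodgeConjecture.Cruxes.H413
open Summit.HodgeConjecture.HodgeConjecture.R90.S1.WildConcaveLevelMinOfRecord

variable (L : Type) [Field L] [NumberField L] [IsCMField L] (v : HeightOneSpectrum (𝓞 ↥(maximalRealSubfield L)))
  (w : PlacesOver L v) (hw : IsCMField.complexConj L • w.1 = w.1)
  (eA : Gqs L v ≃ₜ* ↥(unitaryGroupOfForm (galAdicCompletionMap (L := L) (IsCMField.complexConj L) hw) ((StdForm.antidiagonal 3).over (w.1.adicCompletion L))))
  (heA : ∀ g : Gqs L v,
    ((eA g : ↥(unitaryGroupOfForm (galAdicCompletionMap (L := L) (IsCMField.complexConj L) hw) ((StdForm.antidiagonal 3).over (w.1.adicCompletion L)))) :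
        GL (Fin 3) (w.1.adicCompletion L)) =
      ((localNonsplitEquiv (IsCMField.complexConj L) (qsForm L) (IsCMField.complexConj_ne_one L) w hw g :
        ↥(unitaryGroupOfForm (galAdicCompletionMap (L := L) (IsCMField.complexConj L) hw) (placeForm (qsForm L) w.1))) : GL (Fin 3) (w.1.adicCompletion L)))
  {ϖ : w.1.adicCompletion L} (hϖ : Valued.v ϖ = WithZero.exp (-1 : ℤ))
  (e : Fin 3 → Fin 3 → ℕ)
  (Jg : Subgroup ↥(unitaryGroupOfForm (galAdicCompletionMap (L := L) (IsCMField.complexConj L) hw) ((StdForm.antidiagonal 3).over (w.1.adicCompletion L))))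
  (hJg : ∀ k : ↥(unitaryGroupOfForm (galAdicCompletionMap (L := L) (IsCMField.complexConj L) hw) ((StdForm.antidiagonal 3).over (w.1.adicCompletion L))),
    k ∈ Jg ↔ ∀ i j, Valued.v (((k : GL (Fin 3) (w.1.adicCompletion L)) : Matrix (Fin 3) (Fin 3) (w.1.adicCompletion L)) i j) ≤ Valued.v ϖ ^ e i j)
  (Je : Subgroup (Gqs L v)) (hJe : Je = Jg.comap eA.toMulEquiv.toMonoidHom)

/-! ## §1 Sub-branch (R-a): the F-conductor letter at every level -/

include hw hϖ in
/-- **In (R-a) the F-conductor letter `hcondF` holds at EVERY level `c ≥ 1`**: if `χ₁ a = 1` for every `(c ⊗ 1)`-fixed unit `a` of `L ⊗ L⁺_v` with `|a_{w′}|_{w′} = 1` at all `w′ ∣ v`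
(`hRa0`, ★ (a′)-R `R90S1BposRamShellsVanishOfRecord`'s bytes), then every `(c ⊗ 1)`-fixed unit `u` with `|u_{w′} − 1|_{w′} ≤ |ϖ|^c` has `χ₁ u = 1` (`|ϖ|^c < 1` forces `|u_{w′}| = 1`;
one place `w ∣ v` since `v` is non-split). [cite: Roche1998, §3] -/
theorem hcondF_of_fixTrivial (χ₁ : (LocalRing L v)ˣ →* ℂˣ)
    (hRa0 : ∀ a : (LocalRing L v)ˣ, Units.map (conjLocal L (IsCMField.complexConj L) v : LocalRing L v →* LocalRing L v) a = a →
      (∀ w' : PlacesOver L v, Valued.v ((a : LocalRing L v) w') = 1) → χ₁ a = 1)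
    {c : ℕ} (hc1 : 1 ≤ c) :
    ∀ u : (LocalRing L v)ˣ, Units.map (conjLocal L (IsCMField.complexConj L) v : LocalRing L v →* LocalRing L v) u = u →
      (∀ w' : PlacesOver L v, Valued.v (((u : LocalRing L v) w') - 1) ≤ Valued.v ϖ ^ c) → χ₁ u = 1 := by
  intro u hσu hu
  refine hRa0 u hσu fun w' => ?_
  rw [PlacesOver.eq_of_smul_eq (IsCMField.complexConj L) (IsCMField.complexConj_ne_one L) w hw w']
  have hvϖ1 : Valued.v ϖ < 1 := by rw [hϖ, ← WithZero.exp_zero, WithZero.exp_lt_exp]; norm_num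
  have hlt : Valued.v (((u : LocalRing L v) w) - 1) < 1 := (hu w).trans_lt (pow_lt_one' hvϖ1 (Nat.one_le_iff_ne_zero.1 hc1))
  have e1 : (u : LocalRing L v) w = 1 + (((u : LocalRing L v) w) - 1) := by ring
  rw [e1]
  exact Valuation.map_one_add_of_lt _ hlt

/-! ## §2 Sub-branch (R-a) with the DEFECT LETTER: the CM twin of (W-3) §2 -/

open Classical in
include heA hϖ hJg hJe in
/-- **`θ(jj′) = θ(j)·θ(j′)` ON `Je` IN SUB-BRANCH (R-a) WITH THE DEFECT LETTER** (`θ(g) := if h : IsUnit g₀₀ then χ₁(h.unit) else 0`).  `χ₁ : (L ⊗ L⁺_v)ˣ → ℂˣ` of E-conductor `≤ n`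
(`hcond`) with `χ₁ = 1` on the `(c ⊗ 1)`-fixed units of valuation one (`hRa0`); ANY trace-one `t ∈ L_w` (`t + σ_w t = 1`) with the DEFECT LETTER `|t|·|ϖ|^δ ≤ 1` (`δ = d − 1` at a
wild place via ★ (W-0)'s minimal element; `δ = 0`, `t` integral, at a tame∕unramified one); exponents with `1 ≤ e 1 0`, `1 ≤ e 2 0`, `1 ≤ e 0 2 + e 2 0` and `n ≤ e 0 1 + e 1 0`,
`n + δ ≤ e 0 2 + 2·e 1 0`, `n + δ ≤ e 2 0 + 2·e 0 1` (for `e = (r, s; r′, s′)` with `r + r′ = n`, `s + s′ = 2δ` these are the (W-3) window «`n ≥ δ`»).  One term: (W-0b)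
`theta_mul_concave_ofRecord` at `c := 1` with `hcondF :=` §1 and `|t|·|ϖ|^k = (|t|·|ϖ|^δ)·|ϖ|^{k−δ} ≤ |ϖ|ⁿ` for `n + δ ≤ k`. [cite: Roche1998, §3] [cite: Tits1979, §1.15]
[cite: BruhatTits1972, (6.4.9)] [cite: MoyPrasad1996, §3] -/
theorem theta_mul_of_fixTrivial_of_defect (h10e : 1 ≤ e 1 0) (h20e : 1 ≤ e 2 0) (χ₁ : (LocalRing L v)ˣ →* ℂˣ) {n δ : ℕ}
    (hcond : ∀ u : (LocalRing L v)ˣ, (∀ w' : PlacesOver L v, Valued.v (((u : LocalRing L v) w') - 1) ≤ Valued.v ϖ ^ n) → χ₁ u = 1)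
    (hRa0 : ∀ a : (LocalRing L v)ˣ, Units.map (conjLocal L (IsCMField.complexConj L) v : LocalRing L v →* LocalRing L v) a = a →
      (∀ w' : PlacesOver L v, Valued.v ((a : LocalRing L v) w') = 1) → χ₁ a = 1)
    {t : w.1.adicCompletion L} (ht : t + galAdicCompletionMap (L := L) (IsCMField.complexConj L) hw t = 1)
    (hδ : Valued.v t * Valued.v ϖ ^ δ ≤ 1)
    (h1 : n ≤ e 0 1 + e 1 0) (h2 : n + δ ≤ e 0 2 + 2 * e 1 0) (h3 : n + δ ≤ e 2 0 + 2 * e 0 1) (h4 : 1 ≤ e 0 2 + e 2 0)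
    {j j' : Gqs L v} (hj : j ∈ Je) (hj' : j' ∈ Je) :
    (if h : IsUnit ((((j * j').val : GL (Fin 3) (LocalRing L v)) : Matrix (Fin 3) (Fin 3) (LocalRing L v)) 0 0) then ((χ₁ h.unit : ℂˣ) : ℂ) else 0) =
      (if h : IsUnit (((j.val : GL (Fin 3) (LocalRing L v)) : Matrix (Fin 3) (Fin 3) (LocalRing L v)) 0 0) then ((χ₁ h.unit : ℂˣ) : ℂ) else 0) *
        (if h : IsUnit (((j'.val : GL (Fin 3) (LocalRing L v)) : Matrix (Fin 3) (Fin 3) (LocalRing L v)) 0 0) then ((χ₁ h.unit : ℂˣ) : ℂ) else 0) := by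
  -- `|t|·|ϖ|^k ≤ |ϖ|ⁿ` whenever `n + δ ≤ k`
  have hvϖ1 : Valued.v ϖ ≤ 1 := by rw [hϖ, ← WithZero.exp_zero, WithZero.exp_le_exp]; norm_num
  have hweight : ∀ k : ℕ, n + δ ≤ k → Valued.v t * Valued.v ϖ ^ k ≤ Valued.v ϖ ^ n := by
    intro k hk
    calc Valued.v t * Valued.v ϖ ^ k ≤ Valued.v t * Valued.v ϖ ^ (n + δ) := mul_le_mul' le_rfl (pow_le_pow_right_of_le_one' hvϖ1 hk)
      _ = (Valued.v t * Valued.v ϖ ^ δ) * Valued.v ϖ ^ n := by rw [pow_add]; ac_rfl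
      _ ≤ 1 * Valued.v ϖ ^ n := mul_le_mul' hδ le_rfl
      _ = Valued.v ϖ ^ n := one_mul _
  exact theta_mul_concave_ofRecord L v w hw eA heA hϖ e Jg hJg Je hJe h10e h20e χ₁ le_rfl hcond (hcondF_of_fixTrivial L v w hw hϖ χ₁ hRa0 le_rfl) ht h1
    (hweight _ h2) (hweight _ h3) h4 hj hj'

end Summit.HodgeConjecture.HodgeConjecture.R90.S1.WildThetaMulConcaveMinCM

end
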